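import Summits.QuantumFields.YangMills.Theorems.LuscherReductionTwistedTraceScalingBODefectRates
import Summits.QuantumFields.YangMills.Theorems.FlatTubeReductionFibreMassRecordNumerology
import HarnessLib

/-!
# SUPER-POLYNOMIAL DEFECT PIECES ARE `O(λ_b²)` (indeed `o(λ_b²)`): the rate-twin form `∀ a > 0, ∀ᶠ β, b β² ≤ a·bareLambda(L³β)²` for rates `b² ≤ P·e^{−q·btLog β²}/(β^{-1})^m`
# (route `FlatTubeReduction`, crux K1 `NearFlatRatioLaw` stmt-QuantumFields-24720; seat `ym-line-ftr-p1` g17; rate twin «ratepack-v6», stub `stub_hODpot_A`; R2b1 RECORD rung — no summit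
# statement is proved here)

WHY (crux workfile `Lines/ratepack-v6-port-g17.md` §3).  The registered stub `stub_hODpot_A` (lane A's (B-OD) shape with a second-moment potential) asks for the rate `b_A² = O(λ_b(L³β)²)`
where lane A's ✓`hOD_record` has `b² = o(λ_b)`.  Of the four defect pieces (`…BODefectHODFixed.hdef_fixed`: core, FP tail, outer region, dual-BO shell) the three NON-CORE ones are
super-polynomially small (`…BODefectTailRate`, `…BODefectOutRate`, `…BODefectShellRate`: `b_i² ≤ P·e^{−qℓ²}/β^{-m}`), and lane A's `…BODefectRates.sq_rate_small_of_exp_btLog_sq` turns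
that into `∀ a > 0, ∀ᶠ β, b_i² ≤ a·λ_b`.  This file gives the rate-twin form with `λ_b²` — so the non-core pieces of `stub_hODpot_A` port VERBATIM and only the core piece
(central quasimode rate + transport colour term) is crux-sized.
* ★ `sq_rate_small_sq_of_exp_btLog_sq` — `b² ≤ P·e^{−q·btLog β²}/powScale 1 β^m` eventually ⇒ `∀ a > 0, ∀ᶠ β, b β² ≤ a·bareLambda(L³β)²` (divide by `λ_b² ≥ powScale 1/L²`, apply the
  landed lemma to `b/λ_b` with `m+1`, use `λ_b ≤ 1` eventually); ★ `sq_rate_small_sq_of_exp_btLog_sq'` (the `∃ a` form used by `AnalyticRatePotInput.hb_small`).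
HONEST FRAMING: bookkeeping; the core piece of `stub_hODpot_A` is OPEN; femto rung R2b1 (RECORD label); not infinite volume, not a gap, not Clay.  No defs, no named facts, no `sorry`.
-/

set_option autoImplicit false

noncomputable section

open Filter Topology Real
open Literature.MathematicalPhysics.QuantumFieldTheory
open Literature.MathematicalPhysics.QuantumLattice

namespace Summit.QuantumFields.YangMills.Theorems.FemtoTransferGap.TwoLattice.ConstTube

open Summit.QuantumFields.YangMills.Theorems.FemtoTransferGap
open Summit.QuantumFields.YangMills.Theorems.FemtoTransferGap.TwoLattice

variable {L : ℕ} [NeZero L]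

/-- ★ **Super-polynomial rates are `o(λ_b²)`**: if `b β² ≤ P·e^{−q·btLog β²}/powScale 1 β^m` eventually (`q > 0`, `P ≥ 0`), then `∀ a > 0`, eventually `b β² ≤ a·bareLambda(L³β)²`.
[cite: Luscher1983, §1] -/
theorem sq_rate_small_sq_of_exp_btLog_sq {q P : ℝ} (hq : 0 < q) (hP : 0 ≤ P) (m : ℕ) {b : ℝ → ℝ}
    (hb : ∀ᶠ β : ℝ in atTop, b β ^ 2 ≤ P * Real.exp (-(q * btLog β ^ 2)) / powScale 1 β ^ m) :
    ∀ a : ℝ, 0 < a → ∀ᶠ β : ℝ in atTop, b β ^ 2 ≤ a * bareLambda ((L : ℝ) ^ 3 * β) ^ 2 := by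
  intro a ha
  have hL1 : (1 : ℝ) ≤ L := by exact_mod_cast NeZero.one_le
  have hL2 : (0 : ℝ) < (L : ℝ) ^ 2 := by positivity
  -- the rate of `b/λ_b`
  have hb' : ∀ᶠ β : ℝ in atTop, (b β / bareLambda ((L : ℝ) ^ 3 * β)) ^ 2 ≤ (P * (L : ℝ) ^ 2) * Real.exp (-(q * btLog β ^ 2)) / powScale 1 β ^ (m + 1) := by
    filter_upwards [hb, eventually_ge_atTop (1 : ℝ)] with β hbβ hβ1
    have hlam := powScale_le_sq_bareLambda (L := L) hβ1 (show (3 : ℝ) / 4 ≤ 1 by norm_num)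
    have hps : 0 < powScale 1 β := powScale_pos 1 β
    have hlam0 : 0 < bareLambda ((L : ℝ) ^ 3 * β) ^ 2 := lt_of_lt_of_le (by positivity) (show powScale 1 β / (L : ℝ) ^ 2 ≤ _ by rw [div_le_iff₀ hL2]; linarith)
    rw [div_pow, div_le_iff₀ hlam0, pow_succ]
    calc b β ^ 2 ≤ P * Real.exp (-(q * btLog β ^ 2)) / powScale 1 β ^ m := hbβ
      _ = P * Real.exp (-(q * btLog β ^ 2)) / powScale 1 β ^ m * ((L : ℝ) ^ 2 / powScale 1 β) * (powScale 1 β / (L : ℝ) ^ 2) := by field_simp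
      _ ≤ P * Real.exp (-(q * btLog β ^ 2)) / powScale 1 β ^ m * ((L : ℝ) ^ 2 / powScale 1 β) * bareLambda ((L : ℝ) ^ 3 * β) ^ 2 := by
          refine mul_le_mul_of_nonneg_left (by rw [div_le_iff₀ hL2]; linarith) (by positivity)
      _ = P * (L : ℝ) ^ 2 * Real.exp (-(q * btLog β ^ 2)) / (powScale 1 β ^ m * powScale 1 β) * bareLambda ((L : ℝ) ^ 3 * β) ^ 2 := by field_simp
  have h := sq_rate_small_of_exp_btLog_sq (L := L) hq (by positivity) (m + 1) hb' a ha
  -- `λ_b ≤ 1` eventually, so `(b/λ_b)² ≤ aλ_b ≤ a` and `b² ≤ aλ_b²`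
  filter_upwards [h, eventually_ge_atTop (2 : ℝ)] with β hβ hβ2
  have hB : 2 ≤ (L : ℝ) ^ 3 * β := by nlinarith [one_le_pow₀ (M₀ := ℝ) hL1 (n := 3)]
  obtain ⟨hl0, hl1⟩ := bareLambda_pos_le_one hB
  rw [div_pow, div_le_iff₀ (pow_pos hl0 2)] at hβ
  calc b β ^ 2 ≤ a * bareLambda ((L : ℝ) ^ 3 * β) * bareLambda ((L : ℝ) ^ 3 * β) ^ 2 := hβ
    _ ≤ a * 1 * bareLambda ((L : ℝ) ^ 3 * β) ^ 2 := by gcongr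
    _ = a * bareLambda ((L : ℝ) ^ 3 * β) ^ 2 := by ring

/-- ★ The `∃ a` form (the shape of `RateTube.AnalyticRatePotInput.hb_small` and of `stub_hODpot_A`). [folklore] -/
theorem sq_rate_small_sq_of_exp_btLog_sq' {q P : ℝ} (hq : 0 < q) (hP : 0 ≤ P) (m : ℕ) {b : ℝ → ℝ}
    (hb : ∀ᶠ β : ℝ in atTop, b β ^ 2 ≤ P * Real.exp (-(q * btLog β ^ 2)) / powScale 1 β ^ m) :
    ∃ a : ℝ, ∀ᶠ β : ℝ in atTop, b β ^ 2 ≤ a * bareLambda ((L : ℝ) ^ 3 * β) ^ 2 :=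
  ⟨1, by simpa only [one_mul] using sq_rate_small_sq_of_exp_btLog_sq (L := L) hq hP m hb 1 one_pos⟩

end Summit.QuantumFields.YangMills.Theorems.FemtoTransferGap.TwoLattice.ConstTube

end
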